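import Summits.QuantumFields.YangMills.Theorems.Instrument.ClosedComplexTailBound
import Summits.QuantumFields.YangMills.Theorems.Instrument.LoopFreeNetworkBound
import Summits.QuantumFields.YangMills.Theorems.Instrument.ChargedKraftInstances
import Mathlib.Combinatorics.Enumerative.Catalan.Basic
import Mathlib.Data.Nat.Choose.Sum
import Mathlib.Analysis.InnerProductSpace.PiL2
import Mathlib.MeasureTheory.Measure.Haar.Basic
import HarnessLib

/-!
# Crux `BalabanLadder.IR` (stmt-QuantumFields-19354), crux-ideate lens −4 (certified strong door), generation g4 (v1.2, g7: F1′ AND THE TAIL LEMMA CLOSED):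
# the DEGREE-WEIGHTED PARITY-SELECTED TAIL LEMMA and CONTRACTION BOUND (ii) of the u-column door — typed brief for `sc-lean-1`

HONEST FRAMING (binding, ladder X6 ∕ cell B7).  This file is DOOR SUPPORT for the instrument's certified strong-coupling window
(P-B7 «u-column», QUESTIONS.md A-0826-45 (2) ∕ A-0826-46 (2); card `Cruxes/IR/Ideas/ym19354-4-u-column-door.md`), COUNT-NEUTRAL for the
ladder: it does not touch `hmeet : β_exit ≤ β₀` of `Y2Bridge.Window.gapInUnits_of_fronts`, proves nothing about any gauge theory, and is
NOT summit-bearing.  What it contains: (§1) the parity-selected («even») sub-class of closed link-connected plaquette complexes of `ℤ⁴` and the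
INTERTWINER WEIGHT `B(X) = ∏_ℓ Cat(deg_X ℓ / 2)` (`Cat` = Catalan: degrees `2, 4, 6 ↦ 1, 2, 5` = `dim Inv(V_½^{⊗ deg})` for `SU(2)`); (§2) the
WEIGHTED KRAFT BLOCK WEIGHT `bwB c m = Cat((c+m)/2)·x^m·y^c·[c+m even ≥ 2]` at the certified rational point `(x, y) = (7/32, 13/17)` with its
★ six block inequalities and root inequality PROVED (`kraftB_block`, `kraftB_root`: pure arithmetic), the typed TARGET `KraftB`
(= parts 1–2 of `Instrument.ClosedComplexExploration` ∕ `ClosedComplexTailBound` re-run with `bw ↦ bwB`; ★ v1.2: PROVED — `kraftB_holds`, the Catalan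
instance `Instrument.ChargedKraftInstances.chargedCount_catalan_mul_le` (p499384) of sc-lean-1's degree-charged Kraft machine
`Instrument.ClosedComplexKraftWeighted` (p498570) through the bridge `evenWeightedCount_cast_eq_sum`), and the PROVED reduction
`degreeWeightedTailB_of_kraftB : KraftB → DegreeWeightedTailB` (★ v1.2: hence `degreeWeightedTailB_holds`, i.e. `Σ_{X even, rooted, |X| = n} B(X) ≤ (4/5)·(41/4)^n` outright; compare the
unweighted `TailBoundT2` constant `299/20 = 14.95`: the u-column needs `K_B < 29.9` to beat the sup column, sc-plan PB7-STEP0); (§3) the typed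
faces of contraction bound (ii) `|Φ_J(X)| ≤ ∏_ℓ m_ℓ(J)^{1/2}`: F1′ = the LOOP-FREE NETWORK LEMMA `LoopFreeHSBound` (a closed tensor network without
self-loops is bounded by the product of the Hilbert–Schmidt norms of its tensors — the object sc-ref R7.20 (e) wanted typed FIRST; stated over an
explicit finite network; ★ v1.1: PROVED — `loopFreeHSBound_holds`, by specialisation `V = Fin N` of sc-lean-1's tree theorem
`Instrument.LoopFreeNetworkBound.norm_networkValue_le` (p497387, vertex-merge induction = `LEMMA-ucolumn-tail.md` §2; sc-ref READ PASS §6.72); its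
two-vertex instance `loopFree_twoVertex` and the rank-form face `abs_sum_inner_le_card` PROVED), F2 (Haar average of a unitary representation = orthogonal projector onto invariants, named) and the parity
half of (ii) PROVED; the NORMALISATION of (ii′) (`leadingNormalisation n = 2^{⌊4n/3⌋}/4^n ≤ 1`: pairing resolution of the Haar projector + corner-cycle count);
(§4) the leading-layer u-column Kotecký–Preiss criterion, plain and normalised, as `Prop`s.  Paper text: `Cruxes/IR/LEMMA-ucolumn-tail.md`.
STATUS v1.2 (instrument P-B7 STEP-2 (iii), sc-eng-2 ∕ sc-plan 2026-08-27T04:40–05:14Z): the ALL-`J` character-multiplicity row of record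
`radius/SU2-D4-char-KP-ALLJ-v0` — filed v0 with column `rank` (charged-Kraft tail of sc-ref R″ (d), `θ = 21/10`, `(K, G) = (9169/500, 533/1000)`, head
`n ≤ 22`, exact edge `2/25`), RE-ISSUED in place v1.1.1 (sc-plan 05:14Z, index l.194) with the `hs` charge map OF RECORD (`c = ½`, `θ_hs = 3623/2500`,
`(K, G) = (817/50, 14/25)` — i.e. THIS FILE's §3 Hilbert–Schmidt contraction (ii), F1′) — has EXACT edge `β_W = 1/11` (first fail `19/200`; `×1.80` the
sup-activity column `0.0504` at equal depth; rank `2/25` also certified, dominated; grade C|R″; conditional on R″ (a) = F1′ (typed, p497387) + F2∕F3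
(paper), (a′) (paper), (d) (★ v1.2: TYPED AND PROVED — sc-lean-1's weight-generic degree-charged Kraft machine `Instrument.ClosedComplexKraftWeighted`
(p498570) and its instances `Instrument.ChargedKraftInstances` (p499384: rank `533/1000·(9169/500)^n` = the row of record, hs `14/25·(817/50)^n`,
Catalan `4/5·(41/4)^n` = `KraftB` ∕ `DegreeWeightedTailB` below, closed here via the bridge `evenWeightedCount_cast_eq_sum`)); the registered kill
K3 («close if the exact edge of the column of record < 0.0655») did NOT fire (`1/11 = 0.0909`; rank `0.080`).  The B-weighted ∕ species-split Kraft of §2 and `LEMMA` §3–§4 is the instrument's STEP-3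
candidate («ALLJ-v1»), closed until v0 carries a REF line.  All of it sits far inside strong coupling (`1/11 ≪ 2/7 <` Dobrushin `0.36092`): X6 unchanged.
Grade (T) for the proved arithmetic, F1′ and the tail lemma (`KraftB`, `DegreeWeightedTailB`), (S) for the named statements (F2, (ii), the KP
criteria).  No `sorry`.
-/

noncomputable section

open Finset
open scoped BigOperators
open Literature.MathematicalPhysics.QuantumLattice (ZdEdge ZdPlaquette plaquetteEdges plaquettesTouching)
open Literature.MathematicalPhysics.QuantumFieldTheory.Balaban1983to89.StrongCouplingKPWindow
  (links IsLinkConnected IsClosedComplex rootLink closedCount haarMeanSU2)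
open Summit.QuantumFields.YangMills.Theorems.Instrument.ClosedComplexExploration (atLink)
open Summit.QuantumFields.YangMills.Theorems.Instrument.ClosedComplexTailBound (validFamily)

namespace Summit.QuantumFields.YangMills.Cruxes.IR.CruxIdea4G4

/-! ## §1 Parity-selected complexes and the intertwiner weight -/

/-- A plaquette complex is EVEN (parity-selected) when every link lies in an even number of its plaquettes: the support
condition of the LEADING LAYER of the `SU(2)` character expansion — the centre substitution `U_ℓ ↦ −U_ℓ` flips the sign of a
product of fundamental characters through `ℓ` of odd degree, so its Haar integral vanishes. [folklore] -/
def IsEvenComplex (X : Finset (ZdPlaquette 4)) : Prop := ∀ e ∈ links X, Even (atLink X e).card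

/-- `catalanHalf k = Cat(k/2)` for even `k`, `0` for odd `k`: the dimension of the invariant subspace of `V_½^{⊗k}` for `SU(2)`
(`k = 2, 4, 6 ↦ 1, 2, 5`). [folklore] -/
def catalanHalf (k : ℕ) : ℕ := if Even k then catalan (k / 2) else 0

theorem catalanHalf_zero : catalanHalf 0 = 1 := by simp [catalanHalf, catalan_zero]
theorem catalanHalf_one : catalanHalf 1 = 0 := by simp [catalanHalf]
theorem catalanHalf_two : catalanHalf 2 = 1 := by simp [catalanHalf, catalan_one]
theorem catalanHalf_three : catalanHalf 3 = 0 := by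
  have : ¬ Even 3 := by decide
  simp [catalanHalf, this]
theorem catalanHalf_four : catalanHalf 4 = 2 := by
  have : Even 4 := by decide
  simp [catalanHalf, this, catalan_two]
theorem catalanHalf_five : catalanHalf 5 = 0 := by
  have : ¬ Even 5 := by decide
  simp [catalanHalf, this]
theorem catalanHalf_six : catalanHalf 6 = 5 := by
  have : Even 6 := by decide
  simp [catalanHalf, this, catalan_three]

/-- The INTERTWINER WEIGHT `B(X) = ∏_{ℓ ∈ links X} Cat(deg_X ℓ / 2)` = `∏_ℓ rank P_ℓ` for the all-fundamental layer: the u-column weight of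
record (the Hilbert–Schmidt bound (ii) gives the sharper `B(X)^{1/2}`, (ii′) the sharper `2^{⌊4n/3⌋−2n} B(X)`; `= 0` if some degree is odd). [folklore] -/
def intertwinerWeight (X : Finset (ZdPlaquette 4)) : ℕ := ∏ e ∈ links X, catalanHalf (atLink X e).card

open Classical in
/-- The DEGREE-WEIGHTED PARITY-SELECTED COUNT: `Σ B(X)` over closed link-connected EVEN complexes of `n` plaquettes of `ℤ⁴` through
the root link (a sub-sum of the family counted by `closedCount 4 n`, each term weighted by `B(X) ≥ 1`).  The census of record
(sc-plan `PB7-STEP0.json`, two engines) reads `12, 180, 1620, 3276, 61272, 364156, 1915188, 19778760` at `n = 6, 10, 12, …, 22` (odd `n` and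
`n = 8` vanish); these numbers are NOT asserted here. [folklore] -/
def evenWeightedCount (n : ℕ) : ℕ :=
  ∑ X ∈ (validFamily (fun _ => True) (rootLink 4) n).filter IsEvenComplex, intertwinerWeight X

/-- ★ TARGET (the degree-weighted tail lemma, constant of record): `Σ_{X even} B(X) ≤ (4/5)·(41/4)^n`. [folklore] -/
def DegreeWeightedTailB : Prop := ∀ n : ℕ, (evenWeightedCount n : ℝ) ≤ 4 / 5 * (41 / 4 : ℝ) ^ n

/-- BRIDGE for the `KraftB` instantiation (v1.1, g7): the even `B`-weighted census is the sum over ALL valid closed `n`-complexes through the root of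
the intertwiner weight — odd complexes contribute `0` (`intertwinerWeight_eq_zero_of_odd`, §3). [folklore] -/
theorem evenWeightedCount_eq_sum (n : ℕ) :
    evenWeightedCount n = ∑ X ∈ validFamily (fun _ => True) (rootLink 4) n, intertwinerWeight X := by
  classical
  unfold evenWeightedCount
  rw [Finset.sum_filter]
  refine Finset.sum_congr rfl fun X _ => ?_
  split_ifs with h
  · rfl
  · symm
    unfold IsEvenComplex at h
    push Not at h
    obtain ⟨e, he, hodd⟩ := h
    exact prod_eq_zero he (by simp [catalanHalf, hodd])

/-- The same in `ℝ` with the per-link factor exposed: `Σ_{X valid} ∏_{ℓ ∈ links X} Cat(deg_X ℓ / 2)·[deg even]` — so a WEIGHT-GENERIC charged Kraft theorem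
(sc-lean-1's R″ (d) typing, per-link factor `g k := (catalanHalf k : ℝ)`, point `(x, y) = (7/32, 13/17)`, block inequalities `kraftB_block`, root `kraftB_root`)
over `validFamily ⊤ (rootLink 4) n` gives `KraftB` by one `rw`. [folklore] -/
theorem evenWeightedCount_cast_eq_sum (n : ℕ) :
    (evenWeightedCount n : ℝ) = ∑ X ∈ validFamily (fun _ => True) (rootLink 4) n, ∏ e ∈ links X, (catalanHalf (atLink X e).card : ℝ) := by
  rw [evenWeightedCount_eq_sum]
  push_cast [intertwinerWeight]
  rfl

/-! ## §2 The weighted Kraft block weight at `(x, y) = (7/32, 13/17)` and its block inequalities -/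

/-- `x = 7/32`: weight of a new-born plaquette. [folklore] -/
def xB : ℝ := 7 / 32

/-- `y = 13/17` (`≈ 5^{-1/6}`): weight of an already-present plaquette at the decided link. [folklore] -/
def yB : ℝ := 13 / 17

/-- The WEIGHTED block weight: deciding a link at which `c` plaquettes are already born and `m` are new-born costs
`Cat((c+m)/2)·x^m·y^c` (zero unless `c + m` is even and `≥ 2`). [folklore] -/
def bwB (c m : ℕ) : ℝ := if 2 ≤ c + m then (catalanHalf (c + m) : ℝ) * (xB ^ m * yB ^ c) else 0

theorem bwB_nonneg (c m : ℕ) : 0 ≤ bwB c m := by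
  unfold bwB xB yB
  split_ifs
  · positivity
  · exact le_rfl

/-- ★ The BLOCK INEQUALITIES in binomial form: at a link carrying `c` born plaquettes with `a ≤ 6 − c` candidates (a link of `ℤ⁴` lies in
`≤ 6` plaquettes), `Σ_j C(a,j)·bwB c j ≤ 1` — all `28` pairs, by `norm_num`.  Binding rows: `(c, a) = (1, 5)`: `0.99841`; `(6, 0)`: `5·(13/17)^6 = 0.99985`;
the others: `(2,4)`: `0.92726`, `(3,3)`: `0.61038`, `(4,2)`: `0.76579`, `(5,1)`: `0.28604`, `(0,6)`: `0.78701`. [folklore] -/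
theorem kraftB_block_arith (c a : ℕ) (hca : c + a ≤ 6) :
    ∑ j ∈ range (a + 1), (a.choose j : ℝ) * bwB c j ≤ 1 := by
  have hc6 : c ≤ 6 := by omega
  have ha : a ≤ 6 := by omega
  interval_cases c <;> interval_cases a <;>
    first
    | omega
    | norm_num [sum_range_succ, bwB, xB, yB, Nat.choose, catalanHalf_zero, catalanHalf_one, catalanHalf_two,
        catalanHalf_three, catalanHalf_four, catalanHalf_five, catalanHalf_six]

/-- ★ The block inequality in powerset form (the shape consumed by the Kraft induction `ClosedComplexExploration.kraft`). [folklore] -/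
theorem kraftB_block {α : Type*} (A : Finset α) {c : ℕ} (hca : c + A.card ≤ 6) :
    ∑ S ∈ A.powerset, bwB c S.card ≤ 1 := by
  rw [Finset.sum_powerset_apply_card]
  simp only [nsmul_eq_mul]
  exact kraftB_block_arith c A.card hca

/-- ★ The ROOT inequality: all plaquettes through the root are new-born (`c = 0`), `Σ_j C(a,j)·bwB 0 j ≤ 4/5`
(`a = 6`: `15x² + 30x⁴ + 5x⁶ = 0.78701`). [folklore] -/
theorem kraftB_root_arith (a : ℕ) (ha : a ≤ 6) :
    ∑ j ∈ range (a + 1), (a.choose j : ℝ) * bwB 0 j ≤ 4 / 5 := by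
  interval_cases a <;>
    norm_num [sum_range_succ, bwB, xB, yB, Nat.choose, catalanHalf_zero, catalanHalf_one, catalanHalf_two,
      catalanHalf_three, catalanHalf_four, catalanHalf_five, catalanHalf_six]

theorem kraftB_root {α : Type*} (A : Finset α) (hA : A.card ≤ 6) :
    ∑ S ∈ A.powerset, bwB 0 S.card ≤ 4 / 5 := by
  rw [Finset.sum_powerset_apply_card]
  simp only [nsmul_eq_mul]
  exact kraftB_root_arith A.card hA

/-- The growth constant: `1/(x·y³) = (32/7)·(17/13)³ = 157216/15379 = 10.2228… ≤ 41/4`. [folklore] -/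
theorem inv_xB_yB_cube_le : (xB * yB ^ 3)⁻¹ ≤ 41 / 4 := by
  norm_num [xB, yB]

theorem xB_yB_pos : 0 < xB * yB ^ 3 := by norm_num [xB, yB]

/-- ★ TYPED BRIEF (v1.2: CLOSED below, `kraftB_holds`): the WEIGHTED KRAFT TAIL INEQUALITY — re-run `ClosedComplexExploration` (§2 `wt`, `kraft`, §3 `W`,
`kraft_root_sum`) with `bw ↦ bwB` (block inequality = `kraftB_block`, root = `kraftB_root`) and `ClosedComplexTailBound.W_lower` with the extra
factor `∏_{decided links} Cat(deg/2) = B(X)` (at the block deciding `ℓ`, `c + m = deg_X ℓ` by `card_atLink_split`; every link of `X` is decided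
exactly once), for `Adm = ⊤` and EVEN closed complexes (`deg` even `≥ 2` at every link, so no block weight vanishes). [folklore] -/
def KraftB : Prop := ∀ n : ℕ, (evenWeightedCount n : ℝ) * (xB ^ n * yB ^ (3 * n)) ≤ 4 / 5

/-- ★ PROVED REDUCTION: the weighted Kraft inequality gives the degree-weighted tail lemma with constant `41/4`. [folklore] -/
theorem degreeWeightedTailB_of_kraftB (hK : KraftB) : DegreeWeightedTailB := by
  intro n
  have hpos : 0 < xB ^ n * yB ^ (3 * n) := by
    have := xB_yB_pos
    rw [pow_mul, ← mul_pow]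
    · exact pow_pos this n
  have hK' := hK n
  have hle : (evenWeightedCount n : ℝ) ≤ 4 / 5 * (xB ^ n * yB ^ (3 * n))⁻¹ := by
    rw [← div_eq_mul_inv, le_div_iff₀ hpos]
    exact hK'
  refine hle.trans ?_
  have hrw : (xB ^ n * yB ^ (3 * n))⁻¹ = ((xB * yB ^ 3)⁻¹) ^ n := by
    rw [pow_mul, ← mul_pow, inv_pow]
  rw [hrw]
  have h1 : ((xB * yB ^ 3)⁻¹) ^ n ≤ (41 / 4 : ℝ) ^ n :=
    pow_le_pow_left₀ (inv_nonneg.2 xB_yB_pos.le) inv_xB_yB_cube_le n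
  linarith

/-- ★ `KraftB` CLOSED (v1.2, g7): the Catalan-charged instance of sc-lean-1's DEGREE-CHARGED KRAFT MACHINE
(`Instrument.ClosedComplexKraftWeighted.weightedCount_mul_le`, p498570) at `(x, y, g) = (7/32, 13/17, Cat½)` —
`Instrument.ChargedKraftInstances.chargedCount_catalan_mul_le` (sc-ref READ PASS §6.75) — via the bridge `evenWeightedCount_cast_eq_sum`. [folklore] -/
theorem kraftB_holds : KraftB := fun n => by
  rw [evenWeightedCount_cast_eq_sum]
  exact Summit.QuantumFields.YangMills.Theorems.Instrument.ChargedKraftInstances.chargedCount_catalan_mul_le (rootLink 4) n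

/-- ★ THE DEGREE-WEIGHTED TAIL LEMMA HOLDS (v1.2): `Σ_{X even, rooted, |X| = n} B(X) ≤ (4/5)·(41/4)^n` for every `n` — the (α) binding item of
instrument A-0826-46 (2) as a hypothesis-free theorem. [folklore] -/
theorem degreeWeightedTailB_holds : DegreeWeightedTailB := degreeWeightedTailB_of_kraftB kraftB_holds

/-! ## §3 Contraction bound (ii): the loop-free network lemma F1′ (typed; v1.1: PROVED via the tree), face F1 (proved), F2 and (ii) (named) -/

/-- The edges of a network incident to vertex `v` (`src`/`tgt` endpoint maps into `Fin N`); an `abbrev`, so the subtype's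
`Fintype`/`DecidableEq` instances are found by unfolding (no instance declarations in this file). -/
abbrev Inc {N : ℕ} {E : Type} (src tgt : E → Fin N) (v : Fin N) : Type :=
  {e : E // src e = v ∨ tgt e = v}

/-- Value of a CLOSED tensor network: vertices `Fin N`, edges `E` with endpoints `src`, `tgt`, bond sizes `d`, complex local tensors `T v`
on the index assignments of the edges incident to `v`; every edge index is summed.  (For (ii): vertices = links of `X`, edges = corners
`(p, v)` joining the two links of `p` at the lattice vertex `v`, `T_ℓ = P_ℓ` the Haar projector of F2 read as a tensor on its corners.) -/
def networkValue {N : ℕ} {E : Type} [Fintype E] [DecidableEq E] (src tgt : E → Fin N) (d : E → ℕ)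
    (T : (v : Fin N) → (((e : Inc src tgt v) → Fin (d e.1)) → ℂ)) : ℂ :=
  ∑ σ : ((e : E) → Fin (d e)), ∏ v : Fin N, T v (fun e => σ e.1)

/-- Hilbert–Schmidt (Frobenius, `ℓ²`) norm of the local tensor at `v`. -/
def hsNorm {N : ℕ} {E : Type} [Fintype E] [DecidableEq E] (src tgt : E → Fin N) (d : E → ℕ)
    (v : Fin N) (Tv : ((e : Inc src tgt v) → Fin (d e.1)) → ℂ) : ℝ :=
  Real.sqrt (∑ τ : ((e : Inc src tgt v) → Fin (d e.1)), ‖Tv τ‖ ^ 2)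

/-- ★ FACE F1′ = the LOOP-FREE NETWORK LEMMA (typed; sc-ref R7.20 (e): «the first typed object should be the loop-free lemma»).
A closed tensor network WITHOUT SELF-LOOPS (`src e ≠ tgt e`; parallel edges and cycles allowed) satisfies `‖value‖ ≤ ∏_v ‖T_v‖_HS`.
Proof (paper, `LEMMA-ucolumn-tail.md` §2): merge two vertices at a time contracting ALL edges between them (`‖Aᵀ B‖_HS ≤ ‖A‖_HS ‖B‖_HS`,
Mathlib `Matrix.frobenius_norm_mul`); the merged network is again loop-free and no blob ever carries an internal edge.  A self-loop breaks it
(`tr(1/√d) = √d`).  With `T_ℓ = P_ℓ` (`‖P_ℓ‖_HS = (rank P_ℓ)^{1/2} = m_ℓ(J)^{1/2}`) this IS contraction bound (ii) in the Hilbert–Schmidt form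
`|Φ_J(X)| ≤ ∏_ℓ m_ℓ(J)^{1/2}` (sharper than the rank form `∏ m_ℓ`).  PROVED below (`loopFreeHSBound_holds`, v1.1). [folklore] -/
def LoopFreeHSBound : Prop :=
  ∀ (N : ℕ) (E : Type) [Fintype E] [DecidableEq E] (src tgt : E → Fin N) (d : E → ℕ)
    (T : (v : Fin N) → (((e : Inc src tgt v) → Fin (d e.1)) → ℂ)),
    (∀ e, src e ≠ tgt e) →
      ‖networkValue src tgt d T‖ ≤ ∏ v : Fin N, hsNorm src tgt d v (T v)

/-- ★ F1′ CLOSED (v1.1, g7): the loop-free network lemma HOLDS — by specialisation `V = Fin N` of sc-lean-1's tree theorem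
`Instrument.LoopFreeNetworkBound.norm_networkValue_le` (p497387; strong induction on the number of edges by vertex merge along an edge,
Cauchy–Schwarz for the merged tensor; sc-ref READ PASS REFEREE §6.72).  This file's `Inc` ∕ `networkValue` ∕ `hsNorm` and the tree module's agree
definitionally, so the closing term is the announced one-liner (planner READ: farm rc 0). [folklore] -/
theorem loopFreeHSBound_holds : LoopFreeHSBound :=
  fun N _ _ _ src tgt d T h =>
    Summit.QuantumFields.YangMills.Theorems.Instrument.LoopFreeNetworkBound.norm_networkValue_le_fin N src tgt h d T

/-- Sanity instance of F1′ (PROVED): two vertices joined by parallel edges bundled into one index of size `n`, tensors = vectors `a`, `b`;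
the network value is `Σ i, a i * b i` and the bound is Cauchy–Schwarz — the single step the merge induction iterates. [folklore] -/
theorem loopFree_twoVertex (n : ℕ) (a b : Fin n → ℂ) :
    ‖∑ i, a i * b i‖ ≤ Real.sqrt (∑ i, ‖a i‖ ^ 2) * Real.sqrt (∑ i, ‖b i‖ ^ 2) := by
  have h := norm_inner_le_norm (𝕜 := ℂ) ((WithLp.equiv 2 (Fin n → ℂ)).symm (star a))
    ((WithLp.equiv 2 (Fin n → ℂ)).symm b)
  simp only [EuclideanSpace.norm_eq, PiLp.inner_apply] at h
  simpa [mul_comm] using h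

/-- FACE F1, rank form (PROVED): for unit vectors `v_α` (`α < r`) and a norm-non-increasing map `S`, `‖Σ_α ⟨v_α, S v_α⟩‖ ≤ r` — the
abstract shape of sc-ref's site-factorised proof of the RANK form `|Φ_J| ≤ ∏ m_ℓ` (expand each `P_ℓ` in an orthonormal basis of invariants,
`r = ∏_ℓ m_ℓ(J)` terms each of modulus `≤ 1` by F1′ at unit tensors).  Kept for the record; F1′ supersedes it. [folklore] -/
theorem abs_sum_inner_le_card {E : Type*} [NormedAddCommGroup E] [InnerProductSpace ℂ E] {r : ℕ} (v : Fin r → E)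
    (hv : ∀ α, ‖v α‖ = 1) (S : E →ₗ[ℂ] E) (hS : ∀ w, ‖S w‖ ≤ ‖w‖) :
    ‖∑ α, inner ℂ (v α) (S (v α))‖ ≤ r := by
  calc ‖∑ α, inner ℂ (v α) (S (v α))‖ ≤ ∑ α, ‖inner ℂ (v α) (S (v α))‖ := norm_sum_le _ _
    _ ≤ ∑ _α : Fin r, (1 : ℝ) := by
        refine sum_le_sum fun α _ => ?_
        calc ‖inner ℂ (v α) (S (v α))‖ ≤ ‖v α‖ * ‖S (v α)‖ := norm_inner_le_norm _ _
          _ ≤ 1 * 1 := by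
              refine mul_le_mul (le_of_eq (hv α)) ((hS _).trans (le_of_eq (hv α))) (norm_nonneg _) zero_le_one
          _ = 1 := mul_one _
    _ = r := by simp

/-- FACE F2 (named): for a compact group `G` and a continuous unitary matrix representation `π`, the entrywise Haar average
`P = ∫ π(g) dg` is a Hermitian idempotent whose fixed vectors are exactly the `π`-invariant vectors (so `rank P = dim Inv π`).  Standard
(Peter–Weyl ∕ Schur orthogonality, e.g. Bröcker–tom Dieck II.4); Mathlib has the finite-group case `Representation.averageMap`. [folklore] -/
def HaarAverageIsProjector : Prop :=
  ∀ (G : Type) [Group G] [TopologicalSpace G] [IsTopologicalGroup G] [CompactSpace G] [MeasurableSpace G] [BorelSpace G]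
    (N : ℕ) (π : G →* Matrix.unitaryGroup (Fin N) ℂ), Continuous (fun g => (π g : Matrix (Fin N) (Fin N) ℂ)) →
    let μ : MeasureTheory.Measure G := MeasureTheory.Measure.haarMeasure ⊤
    let P : Matrix (Fin N) (Fin N) ℂ := fun i j => ∫ g, (π g : Matrix (Fin N) (Fin N) ℂ) i j ∂μ
    P * P = P ∧ P.conjTranspose = P ∧
      ∀ v : Fin N → ℂ, P.mulVec v = v ↔ ∀ g : G, (π g : Matrix (Fin N) (Fin N) ℂ).mulVec v = v

/-- CONTRACTION BOUND (ii) (named, informal content in the docstring; its typed faces are F1′ `LoopFreeHSBound`, F2, and the corner-network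
wiring identity F3 of `LEMMA-ucolumn-tail.md` §2): for a finite plaquette complex `X ⊆ ℤ⁴` and an assignment `J` of `SU(2)` irreps to its
plaquettes, `|∫ ∏_{p ∈ X} χ_{j_p}(U_∂p) ∏_ℓ dU_ℓ| ≤ ∏_{ℓ ∈ links X} m_ℓ(J)^{1/2} ≤ ∏_ℓ m_ℓ(J)`, `m_ℓ(J) = dim Inv(⊗_{p ∋ ℓ} V_{j_p})`, and it
VANISHES unless the half-integer-labelled plaquettes have even degree at every link (centre parity); for the all-fundamental assignment the rank
form is `intertwinerWeight X`.  Typed here only in its parity half (the leading-layer weight vanishes off even complexes); the Haar-integral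
typing over `LGConfig` is crew (b)'s. [folklore] -/
def ContractionBoundIILeading : Prop :=
  ∀ X : Finset (ZdPlaquette 4), ¬ IsEvenComplex X → intertwinerWeight X = 0

/-- The parity half of (ii) at the level of the weight: a complex with an odd-degree link has `B(X) = 0` (PROVED). [folklore] -/
theorem intertwinerWeight_eq_zero_of_odd : ContractionBoundIILeading := by
  intro X hX
  unfold IsEvenComplex at hX
  push Not at hX
  obtain ⟨e, he, hodd⟩ := hX
  unfold intertwinerWeight
  exact prod_eq_zero he (by simp [catalanHalf, hodd])

/-- ★ PAIRING RESOLUTION + NORMALISED CONTRACTION BOUND (ii′) (named; proof in `LEMMA-ucolumn-tail.md` §3): the Haar projector onto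
`Inv((ℂ²)^{⊗k})` is `P_k = (Cat(k/2) / ((k−1)!!·2^{k/2})) · Σ_{π pairing} |π⟩⟨π|` (Schur: `Inv` is the irreducible `S_k`-module `S^{(k/2,k/2)}`),
whence `|Φ_½(X)| ≤ 2^{#corner-cycles} · ∏_ℓ Cat(deg ℓ/2)·2^{−deg ℓ/2} ≤ 2^{⌊4n/3⌋ − 2n} · B(X)` (every corner cycle has `≥ 3` corners, `4n` corners;
`Σ_ℓ deg ℓ = 4n`); exact on the cube (`2^{8−12} = 1/16`).  Recorded as the per-`n` normalisation factor of the leading layer. [folklore] -/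
def leadingNormalisation (n : ℕ) : ℝ := (2 : ℝ) ^ (4 * n / 3) / (4 : ℝ) ^ n

theorem leadingNormalisation_le_one (n : ℕ) : leadingNormalisation n ≤ 1 := by
  unfold leadingNormalisation
  rw [div_le_one (by positivity)]
  calc (2 : ℝ) ^ (4 * n / 3) ≤ (2 : ℝ) ^ (2 * n) := pow_le_pow_right₀ (by norm_num) (by omega)
    _ = (4 : ℝ) ^ n := by rw [pow_mul]; norm_num

/-! ## §4 The leading-layer u-column Kotecký–Preiss criterion (named) -/

/-- `u(β_W) = I₂(β_W)/I₁(β_W)`: the fundamental character coefficient of `exp(β_t Re tr U)/c₀` on `SU(2)`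
(`(2/π)∫₀^π e^{β_W cos θ} cos θ sin² θ dθ / c₀(β_W)`; `β_W = 2β_t`). [cite: MontvayMunster1994, §3.4 (3.120)-(3.123)] -/
def uSU2 (βW : ℝ) : ℝ :=
  ((2 / Real.pi) * ∫ θ in (0 : ℝ)..Real.pi, Real.exp (βW * Real.cos θ) * Real.cos θ * Real.sin θ ^ 2) / haarMeanSU2 βW

/-- The LEADING-LAYER u-COLUMN KP criterion on `[0, β₀W]`: `∃ α > 0, Σ_n (Σ_{X even} B(X))·(2u)^n·e^{(2α+δ)n} ≤ α` — the sup-activity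
column `KPCriterionSU2` of the tree with `closedCount 4 n · activitySup^n` replaced by `evenWeightedCount n · (2u)^n` (contraction bound (ii),
leading layer; the all-`J` column adds the higher-irrep layers, `LEMMA-ucolumn-tail.md` §4).  PLANNING edge (v0 functional, head `n ≤ 22` from
PB7-STEP0, tail `DegreeWeightedTailB`; a float, not a certificate): `β_W ≈ 0.154` vs `0.0504` for the sup column at equal depth — below the Dobrushin
(`0.36092`) and KR (`2/9`) doors: count-neutral.  (The CERTIFIED all-`J` row of record `radius/SU2-D4-char-KP-ALLJ-v0` — v0 rank edge `2/25`, re-issue v1.1.1 hs edge `1/11` — uses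
sc-ref's degree-charged Kraft tail R″ (d), not this file's B-weights — see the header STATUS.) [folklore] -/
def KPCriterionUColLeading (δ β₀W : ℝ) : Prop :=
  ∃ α : ℝ, 0 < α ∧ ∀ βW : ℝ, 0 ≤ βW → βW ≤ β₀W →
    Summable (fun n : ℕ => (evenWeightedCount n : ℝ) * (2 * uSU2 βW) ^ n * Real.exp ((2 * α + δ) * n)) ∧
    ∑' n : ℕ, (evenWeightedCount n : ℝ) * (2 * uSU2 βW) ^ n * Real.exp ((2 * α + δ) * n) ≤ α

/-- The NORMALISED leading-layer u-column criterion (contraction bound (ii′) in place of (ii)): weight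
`2^{⌊4n/3⌋−2n}·(Σ_{X even} B(X))·(2u)^n`, i.e. per-plaquette activity `2^{1/3}·u` instead of `2u`.  PLANNING edge (same replay; float):
`β_W ≈ 0.245` (above the KR radius `2/9`, below the Dobrushin door `0.36092`): still count-neutral; tail-dominated (`K_B·2^{1/3}·u = 0.79` at the edge),
so the next lever is the tail constant, not the head. [folklore] -/
def KPCriterionUColNormalised (δ β₀W : ℝ) : Prop :=
  ∃ α : ℝ, 0 < α ∧ ∀ βW : ℝ, 0 ≤ βW → βW ≤ β₀W →
    Summable (fun n : ℕ => leadingNormalisation n * (evenWeightedCount n : ℝ) * (2 * uSU2 βW) ^ n * Real.exp ((2 * α + δ) * n)) ∧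
    ∑' n : ℕ, leadingNormalisation n * (evenWeightedCount n : ℝ) * (2 * uSU2 βW) ^ n * Real.exp ((2 * α + δ) * n) ≤ α

/-- The normalised criterion is implied by the plain one termwise (`leadingNormalisation n ≤ 1`) — recorded at the level of the general
term. [folklore] -/
theorem normalised_term_le (n : ℕ) (βW α δ : ℝ) (hu : 0 ≤ uSU2 βW) :
    leadingNormalisation n * (evenWeightedCount n : ℝ) * (2 * uSU2 βW) ^ n * Real.exp ((2 * α + δ) * n) ≤
      (evenWeightedCount n : ℝ) * (2 * uSU2 βW) ^ n * Real.exp ((2 * α + δ) * n) := by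
  have h0 : 0 ≤ (evenWeightedCount n : ℝ) * (2 * uSU2 βW) ^ n * Real.exp ((2 * α + δ) * n) := by positivity
  have h1 : 0 ≤ leadingNormalisation n := by unfold leadingNormalisation; positivity
  calc leadingNormalisation n * (evenWeightedCount n : ℝ) * (2 * uSU2 βW) ^ n * Real.exp ((2 * α + δ) * n)
      = leadingNormalisation n * ((evenWeightedCount n : ℝ) * (2 * uSU2 βW) ^ n * Real.exp ((2 * α + δ) * n)) := by ring
    _ ≤ 1 * ((evenWeightedCount n : ℝ) * (2 * uSU2 βW) ^ n * Real.exp ((2 * α + δ) * n)) :=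
        mul_le_mul_of_nonneg_right (leadingNormalisation_le_one n) h0
    _ = _ := one_mul _

end Summit.QuantumFields.YangMills.Cruxes.IR.CruxIdea4G4

end
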